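import Summits.SmoothPoincare4.SmoothPoincare4.Theorems.SullivanDualHyperbolicEndTaubesModelDefs
import Literature.Geometry.Symplectic.NearSymplecticFlatBirth

/-!
# Route `SullivanDual`, crux `HyperbolicEnd` (stmt-SmoothPoincare4-7825), line `taubes-circle-pencil`:
# the DATA HALF of stub SM `stub_modelFoliation`, staged on the named fact
# `flatNearSymplecticTaubesTubes_exists`

Stub SM of the checked skeleton `Cruxes/HyperbolicEnd/Lines/taubes_circle_pencil.lean` (reshape r2)
concludes `∃ R δ sf₀ Ψ₁ Ψ₂ J π, IsFlatNearSymplecticData R δ sf₀ Ψ₁ Ψ₂ ∧ IsFlatPinnedStructure … ∧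
IsFlatTransparentFoliation … ∧ (finite energy)`.  Its first conjunct — flat near-symplectic data on
`ℝ⁴` standard at infinity with two flat Taubes tubes (`Theorems/SullivanDualHyperbolicEndTaubesModelDefs.lean`)
— is TRUE IN PRINT: Perutz, JSG 4 (2006) Prop. 1.5 (proof via Calabi 1969) and Rem. 1.9 (a pair of
EVEN zero circles is born in a Darboux ball of `(ℝ⁴, ω₀)`, the form unchanged off a ball) + Honda,
Crelle 577 (2004) Thm. 5 = Taubes, GT 2 (1998) §1.c (exact model `ω_A = ωT` along each even circle
after a deformation supported near it) + elementary toroidal coordinates.  The published input is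
vendored as the Literature named fact `Literature.Geometry.Symplectic.flatNearSymplecticTaubesTubes_exists`
(`Literature/Geometry/Symplectic/NearSymplecticFlatBirth.lean`, whose module docstring spells the
derivation), stated over plain calculus on `ℝ⁴` with the model form / tube / core written out and
non-degeneracy asked off the two CORE circles.

This file proves the STAGING theorem (registered helper)
`helper_flatNearSymplecticData_of_flatNearSymplecticTaubesTubes`: the named fact implies the data
conjunct of SM verbatim.  The proof is a repackaging — every clause of the fact is a field of
`IsFlatNearSymplecticData` / `IsFlatTaubesTube` up to `δ`-unfolding of `taubesForm` / `taubesTube` /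
`taubesCore` (checked by the kernel: the fact's inlined formula IS `taubesForm`), and non-degeneracy
off the tubes follows from non-degeneracy off the cores by `taubesCore ⊆ taubesTube δ`
(`helper_taubesCore_subset_tube`).  The stub itself stays open: its other three conjuncts (pinned
`J`, transparent planar `J`-foliation off `Z₀`, leafwise finite energy) are the open content
(worker's analysis `Cruxes/HyperbolicEnd/Lines/taubes-circle-pencil-SM-analysis(-2).md`).
-/

-- the registered namespace `Summit.SmoothPoincare4.SmoothPoincare4.…` repeats a component (P = Sub)
set_option linter.dupNamespace false

noncomputable section

open scoped Manifold ContDiff Topology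
open Set Literature.Geometry.Kaehler Literature.Geometry.Symplectic Literature.Topology.FourManifolds

namespace Summit.SmoothPoincare4.SmoothPoincare4.Cruxes.HyperbolicEnd.TaubesCirclePencil

-- registered signature, verbatim on one line (gate matches name + header textually)
/-- **The data half of stub SM modulo the literature.**  The named fact
`Literature.Geometry.Symplectic.flatNearSymplecticTaubesTubes_exists` (Perutz 2006 Prop. 1.5 /
Rem. 1.9 + Honda 2004 Thm. 5 = Taubes 1998 §1.c, end result: a smooth closed `2`-form on `ℝ⁴` equal to
`ω₀` off a ball, with two flat untwisted Taubes model tubes inside the ball and non-degenerate off the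
two core circles) implies the first conjunct of `stub_modelFoliation` VERBATIM: there are
`R, δ, sf₀, Ψ₁, Ψ₂` with `IsFlatNearSymplecticData R δ sf₀ Ψ₁ Ψ₂`.  Field by field the fact's clauses are
the package's clauses (the inlined model form, tube and core are `taubesForm`, `taubesTube δ`,
`taubesCore` by `rfl`), and non-degeneracy off the cores gives non-degeneracy off the tubes since
`taubesCore ⊆ taubesTube δ` for `0 < δ`. [folklore] -/
theorem helper_flatNearSymplecticData_of_flatNearSymplecticTaubesTubes : Literature.Geometry.Symplectic.flatNearSymplecticTaubesTubes_exists → ∃ (R δ : ℝ) (sf₀ : EuclideanSpace ℝ (Fin 4) → EuclideanSpace ℝ (Fin 4) [⋀^Fin 2]→L[ℝ] ℝ) (Ψ₁ Ψ₂ : EuclideanSpace ℝ (Fin 4) → EuclideanSpace ℝ (Fin 4)), IsFlatNearSymplecticData R δ sf₀ Ψ₁ Ψ₂ := by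
  intro h
  obtain ⟨R, δ, sf, Ψ₁, Ψ₂, hR, hδ, hδ1, hsmooth, hclosed, hstd, h₁, h₂, hdisj, hnd⟩ := h
  refine ⟨R, δ, sf, Ψ₁, Ψ₂, ?_⟩
  exact
    { R_pos := hR
      δ_pos := hδ
      δ_lt_one := hδ1
      contDiff := hsmooth
      extDeriv_eq_zero := hclosed
      eq_std := hstd
      tube₁ := ⟨h₁.1, h₁.2.1, h₁.2.2.1, h₁.2.2.2.1, h₁.2.2.2.2⟩
      tube₂ := ⟨h₂.1, h₂.2.1, h₂.2.2.1, h₂.2.2.2.1, h₂.2.2.2.2⟩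
      disjoint := hdisj
      nondegenerate := fun y hy a ha => hnd y (fun hy' => hy (by
        rcases hy' with hy' | hy'
        · exact Or.inl (Set.image_mono (helper_taubesCore_subset_tube δ hδ) hy')
        · exact Or.inr (Set.image_mono (helper_taubesCore_subset_tube δ hδ) hy'))) a ha }

end Summit.SmoothPoincare4.SmoothPoincare4.Cruxes.HyperbolicEnd.TaubesCirclePencil

end
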